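import Summits.AnomalousDissipation.AnomalousDissipation.Theses.CoherentStates

/-!
# AnomalousDissipation / CoherentStates — assembly item `Assembly3` (stmt-AnomalousDissipation-0437)

Route `AnomalousDissipation/CoherentStates`. The legacy assembly variant
`Assembly3 : ClassicalGlobalIsGlobalLerayHopf → CoherentThesis → AnomalousDissipation`
is settled in one line from the route's deciding theorem `closes : CoherentThesis → AnomalousDissipation`
(route file, rev 6, sorry-free): the bridge hypothesis `ClassicalGlobalIsGlobalLerayHopf` is not even
needed, since `closes` invokes the proved Literature theorem
`Literature.Analysis.FunctionSpaces.Torus.IsClassicalNSSolutionOn.isGlobalLerayHopf` directly.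

Since 2026-08-16 the route file no longer declares `Assembly3` (multi-assembly autofix: duplicate
assembly variants dropped, the proved record of the item kept), so it is re-declared here with the
item's signature verbatim, solely so that its proved record `Assembly3_proof` keeps elaborating
unchanged (same repair as `Theorems/CoherentStatesAssembly2.lean`).
-/

-- `Summit.<Summit>.<Problem>` is the tree's mandated summit-side namespace (CONVENTIONS §2); for this
-- single-conjunct summit the two coincide, so the duplicate is deliberate.
set_option linter.dupNamespace false

namespace Summit.AnomalousDissipation.AnomalousDissipation.Theses.CoherentStates

/-- The legacy assembly variant `Assembly3` of route CoherentStates (item stmt-AnomalousDissipation-0437):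
`ClassicalGlobalIsGlobalLerayHopf → CoherentThesis → AnomalousDissipation` (the item's signature
verbatim; both hypotheses are items still declared by the route file). The route file stopped
declaring it on 2026-08-16 (multi-assembly autofix: duplicate assembly variants dropped, the proved
record of the item kept), so it is re-declared here solely so that its proved record
`Assembly3_proof` below keeps elaborating unchanged (a definition, not a cited fact). -/
def Assembly3 : Prop :=
  ClassicalGlobalIsGlobalLerayHopf → CoherentThesis → AnomalousDissipation

end Summit.AnomalousDissipation.AnomalousDissipation.Theses.CoherentStates

namespace Summit.AnomalousDissipation.AnomalousDissipation.Theorems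

open Summit.AnomalousDissipation.AnomalousDissipation.Theses.CoherentStates

/-- Settles stmt-AnomalousDissipation-0437 (assembly of route CoherentStates, variant `Assembly3`):
`ClassicalGlobalIsGlobalLerayHopf → CoherentThesis → AnomalousDissipation`, immediate from the route's
deciding theorem `closes` (the Leray–Hopf bridge hypothesis is discarded; `closes` uses the proved
Literature theorem `Torus.IsClassicalNSSolutionOn.isGlobalLerayHopf`). [folklore] -/
theorem Assembly3_proof :
    Summit.AnomalousDissipation.AnomalousDissipation.Theses.CoherentStates.Assembly3 := by
  unfold Summit.AnomalousDissipation.AnomalousDissipation.Theses.CoherentStates.Assembly3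
  intro _ hX
  exact closes hX

end Summit.AnomalousDissipation.AnomalousDissipation.Theorems
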